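import Summits.ResolutionOfSingularities.ResolutionOfSingularities.Theses.WildCones
import Summits.ResolutionOfSingularities.ResolutionOfSingularities.Theorems.WildConesNarrowRunsDieStubDict
import Summits.ResolutionOfSingularities.ResolutionOfSingularities.Theorems.WildConesNarrowRunsDieStubSlice
import Summits.ResolutionOfSingularities.ResolutionOfSingularities.Theorems.WildConesNarrowRunsDieStubHomogNear
import Summits.ResolutionOfSingularities.ResolutionOfSingularities.Theorems.WildConesNarrowRunsDieStubHomogTrans
import Summits.ResolutionOfSingularities.ResolutionOfSingularities.Theorems.WildConesNarrowRunsDieStubCoset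
import Summits.ResolutionOfSingularities.ResolutionOfSingularities.Theorems.WildConesNarrowRunsDieStubPartialsDivisible
import Summits.ResolutionOfSingularities.ResolutionOfSingularities.Theorems.WildConesNarrowRunsDieStubFreeEndgame
import HarnessLib

/-!
# Crux `NarrowRunsDie` (stmt-ResolutionOfSingularities-16882) — line `derivlift`, LEAD'S RESHAPE (v3)
# (derivation lift + Frobenius coset; no arc, no moving frame; ONE dictionary stub)
# STATUS: CLOSED — all seven stubs landed under `Theorems/WildConesNarrowRunsDieStub*.lean`
# (p167328 dict, p166989 slice, p166883 homogNear, p167881 homogTrans, p166854 coset,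
# p167076 partialsDivisible, p166865 freeEndgame); the `stub_*` theorems below are now discharged by
# the landed ones (no `sorry` left); the assembled crux is `Theorems/WildConesNarrowRunsDie.lean`.

Route `ResolutionOfSingularities/WildCones`, crux #2 `NarrowRunsDie` (kept VERBATIM; concluded BY NAME by
`NarrowRunsDie_of` / `NarrowRunsDie_proof` below). This is the strategist's line `derivlift`
(`Lines/derivlift.md`) reshaped by the line lead before the first wave: the mathematics and the
composition are unchanged (near-invariance + transversality ⇒ the run is FREE; Frobenius coset of the
pulled-back start series + derivation lift ⇒ `π_m Φ_m(∂_l a₀) ∈ (π_m^p)`; free endgame at the finite stage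
`m = D + 1` contradicts `Isol (run 0)`), but the stub CUT is finer so that the whole
coefficient-calculus ↔ `MvPowerSeries.subst` DICTIONARY sits in one stub and every other stub is either
pure `MvPolynomial`/`MvPowerSeries` algebra or a one-step lemma that may use the dictionary statement
as a hypothesis:

* `stub_dict` (the dictionary, load-bearing, the lead's): for a coefficient function `a` vanishing below
  degree `s`, `σ_{i,τ}(Ser a) = X_i^s · Ser (tr i τ s (dv i s (bl i a)))`, where `σ_{i,τ}` (`sub`) is the
  honest substitution `u_i ↦ u_i, u_j ↦ u_i (u_j + τ_j)` and `bl/dv/tr` are the route's lets verbatim.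
  Char-free, any `s` (for `s = 0` it is the total transform).
* `stub_slice` (one step, uses `stub_dict`): `MultP c` ⇒ the `u_i`-free slice of the successor
  `step i τ c` is the cleaning of the polynomial `g = G(v + u')` (`G = cone c`, `v = e_i + Σ τ_j e_j`,
  `u'` the other variables): `step i τ c A = clean-indicator · coeff_A g` for `A_i = 0`.
* `stub_homogNear` (pure algebra): `G` homogeneous of degree `p`, `coeff_A G(v+u') = 0` for
  `0 < |A| < p` ⇒ `v ∈ L(G)` (the polynomial identity `G(X + vS) = G(X) + G(v) S^p`).
* `stub_homogTrans` (pure algebra): `v ∈ L(G)` (`v_i = 1`), `G'|_{X_i=0} = G|_{X_i=0}` read off the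
  slice, `w ∈ L(G')`, `w_i = 0` ⇒ `w ∈ L(G)` (refuter g2's key lemma `L(G|_H) = L(G) ∩ H`).
* `stub_coset` (uses `stub_dict`): `(∀ m, MultP (run m)) ⇒ Φ_m(a₀) = π_m^p a_m + b^p`.
* `stub_partialsDivisible` (verbatim from v2): derivation lift, every word.
* `stub_freeEndgame` (verbatim from v2): `Isol (run 0)` + FREE + divisibility ⇒ `False`.

PROVED glue (no `sorry` in its own term): `coeff_coneSum`, `isHomogeneous_coneSum` (the route's `cone`
is a degree-`p` form without `X_j^p` terms), `nearInvariant_of : dict → slice → homogNear → nearInvariant`,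
`transversal_of : dict → slice → homogTrans → transversal` (plus the `finrank = 1` step),
`free_of_oneStep : nearInvariant → transversal → (birth's stub_narrowIsFree verbatim)`,
`NarrowRunsDie_of : (the seven stubs) → NarrowRunsDie`, `NarrowRunsDie_proof : NarrowRunsDie`.

Uses of the crux hypotheses: `MultP` at all stages, `dL = 1` at all stages, `Isol` at stage `0` only;
`OrdP`, `p ≠ 2`, `3 ≤ n` unused (consistent with `Cruxes/NarrowRunsDie/Disproof.lean`:
`narrowRunsDie_false_without_Isol` forces `Isol`; `narrowRunsDie_no_uniform_bound` is respected — the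
endgame bound `D + 2` depends on the start state).

In-tree infrastructure the stubs lean on: `Literature.RingTheory.MvPowerSeries.PartialDerivative`
(`pd` = the crux's `pd` let definitionally, `pd_subst` chain rule, `pd_mul`),
`Literature.AlgebraicGeometry.Resolution.MvPowerSeriesChainRule` (`pderiv_subst`),
`Literature.AlgebraicGeometry.Resolution.PowerSeriesPBasis.coeff_pow_char`, Mathlib
`MvPowerSeries.subst/HasSubst/coeff_subst/subst_coe/map_frobenius_expand`, `frobeniusEquiv`.
-/

noncomputable section

-- single-problem summit: the doubled namespace component `ResolutionOfSingularities` is forced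
set_option linter.dupNamespace false

open Summit.ResolutionOfSingularities.ResolutionOfSingularities.Theses.WildCones (NarrowRunsDie)

namespace Summit.ResolutionOfSingularities.ResolutionOfSingularities.Cruxes.NarrowRunsDie.Lines.DerivLift

/-! ## Stub STATEMENTS by name (`Sig.stub_<name>`), typed over the route's inlined `let` calculus
VERBATIM, extended by the three `let`s `sub` / `Phi` / `piE` of the word's substitution calculus. -/

/-- `stub_dict` — THE DICTIONARY (one blow-up; char-free; any `s`): if the coefficient function `a`
vanishes in total degree `< s`, then substituting `u_i ↦ u_i`, `u_j ↦ u_i (u_j + τ_j)` (`j ≠ i`) into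
`Ser a = Σ_A a_A u^A` gives `X_i^s` times the series of `tr i τ s (dv i s (bl i a))` (blow-up chart `i`,
division by `u_i^s`, translation by `τ` — the route's lets verbatim; the `tr` box loses no term).
[cite: arXiv:1802.05010, §3 (point blow-up transformation rules); Kollar2007, §3.7] -/
def Sig.stub_dict : Prop :=
  ∀ (n : ℕ) (κ : Type) [Field κ] (a : (Fin n → ℕ) → κ) (i : Fin n) (τ : Fin n → κ) (s : ℕ),
    let bl : Fin n → ((Fin n → ℕ) → κ) → ((Fin n → ℕ) → κ) := fun i c B => @ite κ (Finset.sum (Finset.univ.erase i) (fun j => B j) ≤ B i) (Classical.dec _) (c (Function.update B i (B i - Finset.sum (Finset.univ.erase i) (fun j => B j)))) 0;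
    let dv : Fin n → ℕ → ((Fin n → ℕ) → κ) → ((Fin n → ℕ) → κ) := fun i s c B => c (Function.update B i (B i + s));
    let tr : Fin n → (Fin n → κ) → ℕ → ((Fin n → ℕ) → κ) → ((Fin n → ℕ) → κ) := fun i τ s c B => Finset.sum (Fintype.piFinset (fun _ : Fin n => Finset.range (B i + s + 1))) (fun D => @ite κ (D i = 0) (Classical.dec _) (c (B + D) * Finset.prod (Finset.univ.erase i) (fun j => ((Nat.choose (B j + D j) (B j) : ℕ) : κ) * τ j ^ (D j))) 0);
    let sub : Fin n → (Fin n → κ) → MvPowerSeries (Fin n) κ → MvPowerSeries (Fin n) κ := fun i τ f => MvPowerSeries.subst (fun j : Fin n => @ite (MvPowerSeries (Fin n) κ) (j = i) (Classical.dec _) (MvPowerSeries.X i) (MvPowerSeries.X i * (MvPowerSeries.X j + MvPowerSeries.C (τ j)))) f;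
    (∀ A, a A ≠ 0 → s ≤ Finset.sum Finset.univ (fun j => A j)) →
    sub i τ (show MvPowerSeries (Fin n) κ from fun A : Fin n →₀ ℕ => a ⇑A) =
      MvPowerSeries.X i ^ s *
        (show MvPowerSeries (Fin n) κ from fun A : Fin n →₀ ℕ => tr i τ s (dv i s (bl i a)) ⇑A)

/-- `stub_slice` — THE `u_i`-FREE SLICE OF A SUCCESSOR (one blow-up; uses the dictionary): if `c` has
multiplicity `p` (`MultP c`, so the step divides by `u_i^p`), then for every exponent `A` with `A_i = 0`
the successor coefficient `step i τ c A` is the cleaning of the coefficient of `u^A` in the polynomial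
`g = G(v + u') = aeval (X_i ↦ 1, X_j ↦ X_j + τ_j) (cone c)` (`σ(ser c) = σ(G) + σ(higher)`,
`σ(G) = X_i^p g` by homogeneity, `X_i^(p+1) ∣ σ(higher)` by the dictionary again).
[cite: CossartJannsenSaito2020, Thm. 2.14 (setup); arXiv:1802.05010, §3] -/
def Sig.stub_slice : Prop :=
  Sig.stub_dict →
  ∀ p : ℕ, p.Prime → ∀ n : ℕ, 0 < n → ∀ (κ : Type) [Field κ] [CharP κ p] [PerfectField κ]
    (c : (Fin n → ℕ) → κ) (i : Fin n) (τ : Fin n → κ),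
    let clean : ((Fin n → ℕ) → κ) → ((Fin n → ℕ) → κ) := fun c A => @ite κ (∀ j, p ∣ A j) (Classical.dec _) 0 (c A);
    let bl : Fin n → ((Fin n → ℕ) → κ) → ((Fin n → ℕ) → κ) := fun i c B => @ite κ (Finset.sum (Finset.univ.erase i) (fun j => B j) ≤ B i) (Classical.dec _) (c (Function.update B i (B i - Finset.sum (Finset.univ.erase i) (fun j => B j)))) 0;
    let ord : ((Fin n → ℕ) → κ) → ℕ := fun c => sInf {m : ℕ | ∃ A, c A ≠ 0 ∧ m = Finset.sum Finset.univ (fun j => A j)};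
    let dv : Fin n → ℕ → ((Fin n → ℕ) → κ) → ((Fin n → ℕ) → κ) := fun i s c B => c (Function.update B i (B i + s));
    let tr : Fin n → (Fin n → κ) → ℕ → ((Fin n → ℕ) → κ) → ((Fin n → ℕ) → κ) := fun i τ s c B => Finset.sum (Fintype.piFinset (fun _ : Fin n => Finset.range (B i + s + 1))) (fun D => @ite κ (D i = 0) (Classical.dec _) (c (B + D) * Finset.prod (Finset.univ.erase i) (fun j => ((Nat.choose (B j + D j) (B j) : ℕ) : κ) * τ j ^ (D j))) 0);
    let step : Fin n → (Fin n → κ) → ((Fin n → ℕ) → κ) → ((Fin n → ℕ) → κ) := fun i τ c => clean (tr i τ (@ite ℕ (p ≤ ord (clean c)) (Classical.dec _) p 0) (dv i (@ite ℕ (p ≤ ord (clean c)) (Classical.dec _) p 0) (bl i (clean c))));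
    let MultP : ((Fin n → ℕ) → κ) → Prop := fun c => (∃ A, clean c A ≠ 0) ∧ ∀ A, clean c A ≠ 0 → p ≤ Finset.sum Finset.univ (fun j => A j);
    let cone : ((Fin n → ℕ) → κ) → MvPolynomial (Fin n) κ := fun c => Finset.sum (Fintype.piFinset (fun _ : Fin n => Finset.range (p + 1))) (fun A => @ite (MvPolynomial (Fin n) κ) (Finset.sum Finset.univ (fun j => A j) = p) (Classical.dec _) (MvPolynomial.monomial (Finsupp.equivFunOnFinite.symm A) (clean c A)) 0);
    MultP c → ∀ A : Fin n → ℕ, A i = 0 →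
      step i τ c A = @ite κ (∀ j, p ∣ A j) (Classical.dec _) 0
        (MvPolynomial.coeff (Finsupp.equivFunOnFinite.symm A)
          (MvPolynomial.aeval (fun j : Fin n => if j = i then (1 : MvPolynomial (Fin n) κ) else MvPolynomial.X j + MvPolynomial.C (τ j)) (cone c)))

/-- `stub_homogNear` — NEAR DIRECTIONS ARE INVARIANCE DIRECTIONS, the algebra (pure `MvPolynomial`): for a
form `G` of degree `p` in characteristic `p` and `v = e_i + Σ_(j≠i) τ_j e_j`, if the polynomial
`g = G(v + u')` has no monomials of degree `1 … p-1`, then `g = G(v) + G|_(X_i=0)` and, homogenising along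
`v` and using `(X_i + S)^p = X_i^p + S^p`, `G(X + vS) = G(X) + G(v) S^p` — i.e. `v ∈ Linv`.
[cite: CossartJannsenSaito2020, Thm. 2.14] -/
def Sig.stub_homogNear : Prop :=
  ∀ p : ℕ, p.Prime → ∀ (n : ℕ) (κ : Type) [Field κ] [CharP κ p]
    (G : MvPolynomial (Fin n) κ) (i : Fin n) (τ : Fin n → κ),
    G.IsHomogeneous p →
    (∀ A : Fin n →₀ ℕ, A i = 0 → 0 < Finset.sum Finset.univ (fun j => A j) →
      Finset.sum Finset.univ (fun j => A j) < p →
      MvPolynomial.coeff A (MvPolynomial.aeval (fun j : Fin n => if j = i then (1 : MvPolynomial (Fin n) κ) else MvPolynomial.X j + MvPolynomial.C (τ j)) G) = 0) →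
    MvPolynomial.aeval (fun j : Fin n => (MvPolynomial.X (some j) : MvPolynomial (Option (Fin n)) κ) + MvPolynomial.C (Function.update τ i 1 j) * MvPolynomial.X none) G
      = MvPolynomial.rename some G + MvPolynomial.C (MvPolynomial.eval (Function.update τ i 1) G) * (MvPolynomial.X none) ^ p

/-- `stub_homogTrans` — TRANSVERSALITY, the algebra (pure `MvPolynomial`; refuter g2's key lemma
`L(G|_H) = L(G) ∩ H`): `G, G'` forms of degree `p`, `G` without `X_j^p` terms, `v = e_i + Σ τ_j e_j ∈ L(G)`,
the `X_i`-free degree-`p` coefficients of `G'` are the cleaned ones of `g = G(v + u')` (so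
`G'|_(X_i=0) = G|_(X_i=0)`), `w ∈ L(G')` with `w_i = 0`; then `w ∈ L(G)` (write `X = X'' + X_i v`, use the
`L`-identity of `v` under substitution and the `L_H`-identity of `w`). [cite: CossartJannsenSaito2020,
Thm. 3.14; arXiv:1802.05010, §1] -/
def Sig.stub_homogTrans : Prop :=
  ∀ p : ℕ, p.Prime → ∀ (n : ℕ) (κ : Type) [Field κ] [CharP κ p]
    (G G' : MvPolynomial (Fin n) κ) (i : Fin n) (τ w : Fin n → κ),
    G.IsHomogeneous p → G'.IsHomogeneous p →
    (∀ j : Fin n, MvPolynomial.coeff (Finsupp.single j p) G = 0) →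
    w i = 0 →
    MvPolynomial.aeval (fun j : Fin n => (MvPolynomial.X (some j) : MvPolynomial (Option (Fin n)) κ) + MvPolynomial.C (Function.update τ i 1 j) * MvPolynomial.X none) G
      = MvPolynomial.rename some G + MvPolynomial.C (MvPolynomial.eval (Function.update τ i 1) G) * (MvPolynomial.X none) ^ p →
    (∀ A : Fin n →₀ ℕ, A i = 0 → Finset.sum Finset.univ (fun j => A j) = p →
      MvPolynomial.coeff A G' = @ite κ (∀ j, p ∣ A j) (Classical.dec _) 0
        (MvPolynomial.coeff A (MvPolynomial.aeval (fun j : Fin n => if j = i then (1 : MvPolynomial (Fin n) κ) else MvPolynomial.X j + MvPolynomial.C (τ j)) G))) →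
    MvPolynomial.aeval (fun j : Fin n => (MvPolynomial.X (some j) : MvPolynomial (Option (Fin n)) κ) + MvPolynomial.C (w j) * MvPolynomial.X none) G'
      = MvPolynomial.rename some G' + MvPolynomial.C (MvPolynomial.eval (w) G') * (MvPolynomial.X none) ^ p →
    MvPolynomial.aeval (fun j : Fin n => (MvPolynomial.X (some j) : MvPolynomial (Option (Fin n)) κ) + MvPolynomial.C (w j) * MvPolynomial.X none) G
      = MvPolynomial.rename some G + MvPolynomial.C (MvPolynomial.eval (w) G) * (MvPolynomial.X none) ^ p

/-- `stub_coset` — THE FROBENIUS COSET OF THE PULLED-BACK START SERIES (uses the dictionary): along a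
run all of whose states have multiplicity `p`, `Φ_m(a₀) = π_m^p · a_m + b^p` in `κ[[u]]`, where
`a_m = ser (run m)`, `Φ_m` is the composite substitution of the word and `π_m` the pushed-forward product
of exceptional variables (each step: the dictionary with `s = p`, and cleaning subtracts a `p`-th power
over the perfect field `κ`; `p`-th powers form a subring stable under `σ`).
[cite: arXiv:1802.05010, §3; Kollar2007, §3.7] -/
def Sig.stub_coset : Prop :=
  Sig.stub_dict →
  ∀ p : ℕ, p.Prime → ∀ n : ℕ, 0 < n → ∀ (κ : Type) [Field κ] [CharP κ p] [PerfectField κ]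
    (c₀ : (Fin n → ℕ) → κ) (i : ℕ → Fin n) (t : ℕ → Fin n → κ),
    let clean : ((Fin n → ℕ) → κ) → ((Fin n → ℕ) → κ) := fun c A => @ite κ (∀ j, p ∣ A j) (Classical.dec _) 0 (c A);
    let bl : Fin n → ((Fin n → ℕ) → κ) → ((Fin n → ℕ) → κ) := fun i c B => @ite κ (Finset.sum (Finset.univ.erase i) (fun j => B j) ≤ B i) (Classical.dec _) (c (Function.update B i (B i - Finset.sum (Finset.univ.erase i) (fun j => B j)))) 0;
    let ord : ((Fin n → ℕ) → κ) → ℕ := fun c => sInf {m : ℕ | ∃ A, c A ≠ 0 ∧ m = Finset.sum Finset.univ (fun j => A j)};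
    let dv : Fin n → ℕ → ((Fin n → ℕ) → κ) → ((Fin n → ℕ) → κ) := fun i s c B => c (Function.update B i (B i + s));
    let tr : Fin n → (Fin n → κ) → ℕ → ((Fin n → ℕ) → κ) → ((Fin n → ℕ) → κ) := fun i τ s c B => Finset.sum (Fintype.piFinset (fun _ : Fin n => Finset.range (B i + s + 1))) (fun D => @ite κ (D i = 0) (Classical.dec _) (c (B + D) * Finset.prod (Finset.univ.erase i) (fun j => ((Nat.choose (B j + D j) (B j) : ℕ) : κ) * τ j ^ (D j))) 0);
    let step : Fin n → (Fin n → κ) → ((Fin n → ℕ) → κ) → ((Fin n → ℕ) → κ) := fun i τ c => clean (tr i τ (@ite ℕ (p ≤ ord (clean c)) (Classical.dec _) p 0) (dv i (@ite ℕ (p ≤ ord (clean c)) (Classical.dec _) p 0) (bl i (clean c))));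
    let run : ((Fin n → ℕ) → κ) → (ℕ → Fin n) → (ℕ → Fin n → κ) → ℕ → ((Fin n → ℕ) → κ) := fun c₀ i t m => @Nat.rec (fun _ => (Fin n → ℕ) → κ) c₀ (fun m c => step (i m) (t m) c) m;
    let ser : ((Fin n → ℕ) → κ) → MvPowerSeries (Fin n) κ := fun c => show MvPowerSeries (Fin n) κ from fun A : Fin n →₀ ℕ => clean c ⇑A;
    let MultP : ((Fin n → ℕ) → κ) → Prop := fun c => (∃ A, clean c A ≠ 0) ∧ ∀ A, clean c A ≠ 0 → p ≤ Finset.sum Finset.univ (fun j => A j);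
    let sub : Fin n → (Fin n → κ) → MvPowerSeries (Fin n) κ → MvPowerSeries (Fin n) κ := fun i τ f => MvPowerSeries.subst (fun j : Fin n => @ite (MvPowerSeries (Fin n) κ) (j = i) (Classical.dec _) (MvPowerSeries.X i) (MvPowerSeries.X i * (MvPowerSeries.X j + MvPowerSeries.C (τ j)))) f;
    let Phi : ℕ → MvPowerSeries (Fin n) κ → MvPowerSeries (Fin n) κ := fun m f => @Nat.rec (fun _ => MvPowerSeries (Fin n) κ) f (fun k g => sub (i k) (t k) g) m;
    let piE : ℕ → MvPowerSeries (Fin n) κ := fun m => @Nat.rec (fun _ => MvPowerSeries (Fin n) κ) 1 (fun k g => MvPowerSeries.X (i k) * sub (i k) (t k) g) m;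
    (∀ m, MultP (run c₀ i t m)) →
    ∀ m, ∃ b : MvPowerSeries (Fin n) κ,
      Phi m (ser (run c₀ i t 0)) = piE m ^ p * ser (run c₀ i t m) + b ^ p

/-- `stub_partialsDivisible` — DERIVATION LIFT (valid for EVERY word, no freeness, no state): if
`Φ_m(g) = π_m^p h + b^p` then `π_m · Φ_m(∂_l g) ∈ π_m^p · κ[[u]]` for every coordinate `l` (the
derivation `π_m ∂_l` lifts through `Φ_m` to `Σ_k c_k ∂_k` by the chain rule for `subst`; derivations
kill `p`-th powers and `δ(π^p h) = π^p δ h` in characteristic `p`). The `pd` let IS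
`Literature.RingTheory.MvPowerSeries.pd` (definitionally). [folklore; cf. Kollar2007, §3.7] -/
def Sig.stub_partialsDivisible : Prop :=
  ∀ p : ℕ, p.Prime → ∀ n : ℕ, 0 < n → ∀ (κ : Type) [Field κ] [CharP κ p]
    (i : ℕ → Fin n) (t : ℕ → Fin n → κ),
    let pd : Fin n → MvPowerSeries (Fin n) κ → MvPowerSeries (Fin n) κ := fun i f => show MvPowerSeries (Fin n) κ from fun A : Fin n →₀ ℕ => ((A i + 1 : ℕ) : κ) * f (A + Finsupp.single i 1);
    let sub : Fin n → (Fin n → κ) → MvPowerSeries (Fin n) κ → MvPowerSeries (Fin n) κ := fun i τ f => MvPowerSeries.subst (fun j : Fin n => @ite (MvPowerSeries (Fin n) κ) (j = i) (Classical.dec _) (MvPowerSeries.X i) (MvPowerSeries.X i * (MvPowerSeries.X j + MvPowerSeries.C (τ j)))) f;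
    let Phi : ℕ → MvPowerSeries (Fin n) κ → MvPowerSeries (Fin n) κ := fun m f => @Nat.rec (fun _ => MvPowerSeries (Fin n) κ) f (fun k g => sub (i k) (t k) g) m;
    let piE : ℕ → MvPowerSeries (Fin n) κ := fun m => @Nat.rec (fun _ => MvPowerSeries (Fin n) κ) 1 (fun k g => MvPowerSeries.X (i k) * sub (i k) (t k) g) m;
    ∀ (m : ℕ) (l : Fin n) (g h b : MvPowerSeries (Fin n) κ),
      Phi m g = piE m ^ p * h + b ^ p →
      ∃ h' : MvPowerSeries (Fin n) κ, piE m * Phi m (pd l g) = piE m ^ p * h'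

/-- `stub_freeEndgame` — FREE ENDGAME: an isolated start state, a FREE word and the divisibility
`π_m Φ_m(∂_l a₀) ∈ (π_m^p)` for all `m, l` are contradictory: freeness gives `π_m = u_(i (m-1))^m · unit`
and `Φ_m(u_(i 0)) = u_(i (m-1)) · unit`; isolatedness gives `u_(i 0)^D ∈ (∂a₀)`; so
`x^(m+D) · unit ∈ x^(mp) κ[[u]]`, absurd at `m = D + 1` (compare the coefficient of `x^(m+D)`).
[folklore; Mathlib: `MvPowerSeries.isUnit_iff_constantCoeff`, `IsArtinianRing.of_finite`] -/
def Sig.stub_freeEndgame : Prop :=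
  ∀ p : ℕ, p.Prime → ∀ n : ℕ, 0 < n → ∀ (κ : Type) [Field κ] [CharP κ p] [PerfectField κ]
    (c₀ : (Fin n → ℕ) → κ) (i : ℕ → Fin n) (t : ℕ → Fin n → κ),
    let clean : ((Fin n → ℕ) → κ) → ((Fin n → ℕ) → κ) := fun c A => @ite κ (∀ j, p ∣ A j) (Classical.dec _) 0 (c A);
    let bl : Fin n → ((Fin n → ℕ) → κ) → ((Fin n → ℕ) → κ) := fun i c B => @ite κ (Finset.sum (Finset.univ.erase i) (fun j => B j) ≤ B i) (Classical.dec _) (c (Function.update B i (B i - Finset.sum (Finset.univ.erase i) (fun j => B j)))) 0;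
    let ord : ((Fin n → ℕ) → κ) → ℕ := fun c => sInf {m : ℕ | ∃ A, c A ≠ 0 ∧ m = Finset.sum Finset.univ (fun j => A j)};
    let dv : Fin n → ℕ → ((Fin n → ℕ) → κ) → ((Fin n → ℕ) → κ) := fun i s c B => c (Function.update B i (B i + s));
    let tr : Fin n → (Fin n → κ) → ℕ → ((Fin n → ℕ) → κ) → ((Fin n → ℕ) → κ) := fun i τ s c B => Finset.sum (Fintype.piFinset (fun _ : Fin n => Finset.range (B i + s + 1))) (fun D => @ite κ (D i = 0) (Classical.dec _) (c (B + D) * Finset.prod (Finset.univ.erase i) (fun j => ((Nat.choose (B j + D j) (B j) : ℕ) : κ) * τ j ^ (D j))) 0);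
    let step : Fin n → (Fin n → κ) → ((Fin n → ℕ) → κ) → ((Fin n → ℕ) → κ) := fun i τ c => clean (tr i τ (@ite ℕ (p ≤ ord (clean c)) (Classical.dec _) p 0) (dv i (@ite ℕ (p ≤ ord (clean c)) (Classical.dec _) p 0) (bl i (clean c))));
    let run : ((Fin n → ℕ) → κ) → (ℕ → Fin n) → (ℕ → Fin n → κ) → ℕ → ((Fin n → ℕ) → κ) := fun c₀ i t m => @Nat.rec (fun _ => (Fin n → ℕ) → κ) c₀ (fun m c => step (i m) (t m) c) m;
    let ser : ((Fin n → ℕ) → κ) → MvPowerSeries (Fin n) κ := fun c => show MvPowerSeries (Fin n) κ from fun A : Fin n →₀ ℕ => clean c ⇑A;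
    let pd : Fin n → MvPowerSeries (Fin n) κ → MvPowerSeries (Fin n) κ := fun i f => show MvPowerSeries (Fin n) κ from fun A : Fin n →₀ ℕ => ((A i + 1 : ℕ) : κ) * f (A + Finsupp.single i 1);
    let jac : ((Fin n → ℕ) → κ) → Ideal (MvPowerSeries (Fin n) κ) := fun c => Ideal.span (Set.range (fun i => pd i (ser c)));
    let Isol : ((Fin n → ℕ) → κ) → Prop := fun c => Module.Finite κ (MvPowerSeries (Fin n) κ ⧸ jac c);
    let sub : Fin n → (Fin n → κ) → MvPowerSeries (Fin n) κ → MvPowerSeries (Fin n) κ := fun i τ f => MvPowerSeries.subst (fun j : Fin n => @ite (MvPowerSeries (Fin n) κ) (j = i) (Classical.dec _) (MvPowerSeries.X i) (MvPowerSeries.X i * (MvPowerSeries.X j + MvPowerSeries.C (τ j)))) f;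
    let Phi : ℕ → MvPowerSeries (Fin n) κ → MvPowerSeries (Fin n) κ := fun m f => @Nat.rec (fun _ => MvPowerSeries (Fin n) κ) f (fun k g => sub (i k) (t k) g) m;
    let piE : ℕ → MvPowerSeries (Fin n) κ := fun m => @Nat.rec (fun _ => MvPowerSeries (Fin n) κ) 1 (fun k g => MvPowerSeries.X (i k) * sub (i k) (t k) g) m;
    Isol (run c₀ i t 0) →
    (∀ m, i (m + 1) = i m ∨ t (m + 1) (i m) ≠ 0) →
    (∀ (m : ℕ) (l : Fin n), ∃ h' : MvPowerSeries (Fin n) κ,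
        piE m * Phi m (pd l (ser (run c₀ i t 0))) = piE m ^ p * h') →
    False

/-! ## Derived one-step statements (NOT stubs; proved below from the stubs) and birth's freeness node -/

/-- Near directions are invariance directions (v2's `Sig.stub_nearInvariant`, now DERIVED:
`nearInvariant_of`). -/
def Sig.nearInvariant : Prop :=
  ∀ p : ℕ, p.Prime → ∀ n : ℕ, 0 < n → ∀ (κ : Type) [Field κ] [CharP κ p] [PerfectField κ]
    (c : (Fin n → ℕ) → κ) (i : Fin n) (τ : Fin n → κ),
    let clean : ((Fin n → ℕ) → κ) → ((Fin n → ℕ) → κ) := fun c A => @ite κ (∀ j, p ∣ A j) (Classical.dec _) 0 (c A);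
    let bl : Fin n → ((Fin n → ℕ) → κ) → ((Fin n → ℕ) → κ) := fun i c B => @ite κ (Finset.sum (Finset.univ.erase i) (fun j => B j) ≤ B i) (Classical.dec _) (c (Function.update B i (B i - Finset.sum (Finset.univ.erase i) (fun j => B j)))) 0;
    let ord : ((Fin n → ℕ) → κ) → ℕ := fun c => sInf {m : ℕ | ∃ A, c A ≠ 0 ∧ m = Finset.sum Finset.univ (fun j => A j)};
    let dv : Fin n → ℕ → ((Fin n → ℕ) → κ) → ((Fin n → ℕ) → κ) := fun i s c B => c (Function.update B i (B i + s));
    let tr : Fin n → (Fin n → κ) → ℕ → ((Fin n → ℕ) → κ) → ((Fin n → ℕ) → κ) := fun i τ s c B => Finset.sum (Fintype.piFinset (fun _ : Fin n => Finset.range (B i + s + 1))) (fun D => @ite κ (D i = 0) (Classical.dec _) (c (B + D) * Finset.prod (Finset.univ.erase i) (fun j => ((Nat.choose (B j + D j) (B j) : ℕ) : κ) * τ j ^ (D j))) 0);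
    let step : Fin n → (Fin n → κ) → ((Fin n → ℕ) → κ) → ((Fin n → ℕ) → κ) := fun i τ c => clean (tr i τ (@ite ℕ (p ≤ ord (clean c)) (Classical.dec _) p 0) (dv i (@ite ℕ (p ≤ ord (clean c)) (Classical.dec _) p 0) (bl i (clean c))));
    let MultP : ((Fin n → ℕ) → κ) → Prop := fun c => (∃ A, clean c A ≠ 0) ∧ ∀ A, clean c A ≠ 0 → p ≤ Finset.sum Finset.univ (fun j => A j);
    let cone : ((Fin n → ℕ) → κ) → MvPolynomial (Fin n) κ := fun c => Finset.sum (Fintype.piFinset (fun _ : Fin n => Finset.range (p + 1))) (fun A => @ite (MvPolynomial (Fin n) κ) (Finset.sum Finset.univ (fun j => A j) = p) (Classical.dec _) (MvPolynomial.monomial (Finsupp.equivFunOnFinite.symm A) (clean c A)) 0);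
    let Linv : ((Fin n → ℕ) → κ) → Set (Fin n → κ) := fun c => {w : Fin n → κ | MvPolynomial.aeval (fun j : Fin n => (MvPolynomial.X (some j) : MvPolynomial (Option (Fin n)) κ) + MvPolynomial.C (w j) * MvPolynomial.X none) (cone c) = MvPolynomial.rename some (cone c) + MvPolynomial.C (MvPolynomial.eval w (cone c)) * (MvPolynomial.X none) ^ p};
    MultP c → MultP (step i τ c) → Function.update τ i 1 ∈ Linv c

/-- Transversality of the next invariance space (v2's `Sig.stub_transversal`, now DERIVED:
`transversal_of`). -/
def Sig.transversal : Prop :=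
  ∀ p : ℕ, p.Prime → ∀ n : ℕ, 0 < n → ∀ (κ : Type) [Field κ] [CharP κ p] [PerfectField κ]
    (c : (Fin n → ℕ) → κ) (i : Fin n) (τ : Fin n → κ),
    let clean : ((Fin n → ℕ) → κ) → ((Fin n → ℕ) → κ) := fun c A => @ite κ (∀ j, p ∣ A j) (Classical.dec _) 0 (c A);
    let bl : Fin n → ((Fin n → ℕ) → κ) → ((Fin n → ℕ) → κ) := fun i c B => @ite κ (Finset.sum (Finset.univ.erase i) (fun j => B j) ≤ B i) (Classical.dec _) (c (Function.update B i (B i - Finset.sum (Finset.univ.erase i) (fun j => B j)))) 0;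
    let ord : ((Fin n → ℕ) → κ) → ℕ := fun c => sInf {m : ℕ | ∃ A, c A ≠ 0 ∧ m = Finset.sum Finset.univ (fun j => A j)};
    let dv : Fin n → ℕ → ((Fin n → ℕ) → κ) → ((Fin n → ℕ) → κ) := fun i s c B => c (Function.update B i (B i + s));
    let tr : Fin n → (Fin n → κ) → ℕ → ((Fin n → ℕ) → κ) → ((Fin n → ℕ) → κ) := fun i τ s c B => Finset.sum (Fintype.piFinset (fun _ : Fin n => Finset.range (B i + s + 1))) (fun D => @ite κ (D i = 0) (Classical.dec _) (c (B + D) * Finset.prod (Finset.univ.erase i) (fun j => ((Nat.choose (B j + D j) (B j) : ℕ) : κ) * τ j ^ (D j))) 0);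
    let step : Fin n → (Fin n → κ) → ((Fin n → ℕ) → κ) → ((Fin n → ℕ) → κ) := fun i τ c => clean (tr i τ (@ite ℕ (p ≤ ord (clean c)) (Classical.dec _) p 0) (dv i (@ite ℕ (p ≤ ord (clean c)) (Classical.dec _) p 0) (bl i (clean c))));
    let MultP : ((Fin n → ℕ) → κ) → Prop := fun c => (∃ A, clean c A ≠ 0) ∧ ∀ A, clean c A ≠ 0 → p ≤ Finset.sum Finset.univ (fun j => A j);
    let cone : ((Fin n → ℕ) → κ) → MvPolynomial (Fin n) κ := fun c => Finset.sum (Fintype.piFinset (fun _ : Fin n => Finset.range (p + 1))) (fun A => @ite (MvPolynomial (Fin n) κ) (Finset.sum Finset.univ (fun j => A j) = p) (Classical.dec _) (MvPolynomial.monomial (Finsupp.equivFunOnFinite.symm A) (clean c A)) 0);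
    let Linv : ((Fin n → ℕ) → κ) → Set (Fin n → κ) := fun c => {w : Fin n → κ | MvPolynomial.aeval (fun j : Fin n => (MvPolynomial.X (some j) : MvPolynomial (Option (Fin n)) κ) + MvPolynomial.C (w j) * MvPolynomial.X none) (cone c) = MvPolynomial.rename some (cone c) + MvPolynomial.C (MvPolynomial.eval w (cone c)) * (MvPolynomial.X none) ^ p};
    let dL : ((Fin n → ℕ) → κ) → ℕ := fun c => Module.finrank κ (Submodule.span κ (Linv c));
    MultP c → Function.update τ i 1 ∈ Linv c → dL c = 1 →
    ∀ w ∈ Linv (step i τ c), w i = 0 → w = 0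

/-- The birth line's first stub statement, VERBATIM (`Lines/birth.lean`, `Sig.stub_narrowIsFree`):
narrow runs are free. -/
def Sig.narrowIsFree : Prop :=
  ∀ p : ℕ, p.Prime → ∀ n : ℕ, 0 < n → ∀ (κ : Type) [Field κ] [CharP κ p] [PerfectField κ]
    (c₀ : (Fin n → ℕ) → κ) (i : ℕ → Fin n) (t : ℕ → Fin n → κ),
    let clean : ((Fin n → ℕ) → κ) → ((Fin n → ℕ) → κ) := fun c A => @ite κ (∀ j, p ∣ A j) (Classical.dec _) 0 (c A);
    let bl : Fin n → ((Fin n → ℕ) → κ) → ((Fin n → ℕ) → κ) := fun i c B => @ite κ (Finset.sum (Finset.univ.erase i) (fun j => B j) ≤ B i) (Classical.dec _) (c (Function.update B i (B i - Finset.sum (Finset.univ.erase i) (fun j => B j)))) 0;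
    let ord : ((Fin n → ℕ) → κ) → ℕ := fun c => sInf {m : ℕ | ∃ A, c A ≠ 0 ∧ m = Finset.sum Finset.univ (fun j => A j)};
    let dv : Fin n → ℕ → ((Fin n → ℕ) → κ) → ((Fin n → ℕ) → κ) := fun i s c B => c (Function.update B i (B i + s));
    let tr : Fin n → (Fin n → κ) → ℕ → ((Fin n → ℕ) → κ) → ((Fin n → ℕ) → κ) := fun i τ s c B => Finset.sum (Fintype.piFinset (fun _ : Fin n => Finset.range (B i + s + 1))) (fun D => @ite κ (D i = 0) (Classical.dec _) (c (B + D) * Finset.prod (Finset.univ.erase i) (fun j => ((Nat.choose (B j + D j) (B j) : ℕ) : κ) * τ j ^ (D j))) 0);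
    let step : Fin n → (Fin n → κ) → ((Fin n → ℕ) → κ) → ((Fin n → ℕ) → κ) := fun i τ c => clean (tr i τ (@ite ℕ (p ≤ ord (clean c)) (Classical.dec _) p 0) (dv i (@ite ℕ (p ≤ ord (clean c)) (Classical.dec _) p 0) (bl i (clean c))));
    let run : ((Fin n → ℕ) → κ) → (ℕ → Fin n) → (ℕ → Fin n → κ) → ℕ → ((Fin n → ℕ) → κ) := fun c₀ i t m => @Nat.rec (fun _ => (Fin n → ℕ) → κ) c₀ (fun m c => step (i m) (t m) c) m;
    let ser : ((Fin n → ℕ) → κ) → MvPowerSeries (Fin n) κ := fun c => show MvPowerSeries (Fin n) κ from fun A : Fin n →₀ ℕ => clean c ⇑A;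
    let pd : Fin n → MvPowerSeries (Fin n) κ → MvPowerSeries (Fin n) κ := fun i f => show MvPowerSeries (Fin n) κ from fun A : Fin n →₀ ℕ => ((A i + 1 : ℕ) : κ) * f (A + Finsupp.single i 1);
    let jac : ((Fin n → ℕ) → κ) → Ideal (MvPowerSeries (Fin n) κ) := fun c => Ideal.span (Set.range (fun i => pd i (ser c)));
    let Isol : ((Fin n → ℕ) → κ) → Prop := fun c => Module.Finite κ (MvPowerSeries (Fin n) κ ⧸ jac c);
    let MultP : ((Fin n → ℕ) → κ) → Prop := fun c => (∃ A, clean c A ≠ 0) ∧ ∀ A, clean c A ≠ 0 → p ≤ Finset.sum Finset.univ (fun j => A j);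
    let OrdP : ((Fin n → ℕ) → κ) → Prop := fun c => ∃ A, clean c A ≠ 0 ∧ Finset.sum Finset.univ (fun j => A j) = p;
    let cone : ((Fin n → ℕ) → κ) → MvPolynomial (Fin n) κ := fun c => Finset.sum (Fintype.piFinset (fun _ : Fin n => Finset.range (p + 1))) (fun A => @ite (MvPolynomial (Fin n) κ) (Finset.sum Finset.univ (fun j => A j) = p) (Classical.dec _) (MvPolynomial.monomial (Finsupp.equivFunOnFinite.symm A) (clean c A)) 0);
    let Linv : ((Fin n → ℕ) → κ) → Set (Fin n → κ) := fun c => {w : Fin n → κ | MvPolynomial.aeval (fun j : Fin n => (MvPolynomial.X (some j) : MvPolynomial (Option (Fin n)) κ) + MvPolynomial.C (w j) * MvPolynomial.X none) (cone c) = MvPolynomial.rename some (cone c) + MvPolynomial.C (MvPolynomial.eval w (cone c)) * (MvPolynomial.X none) ^ p};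
    let dL : ((Fin n → ℕ) → κ) → ℕ := fun c => Module.finrank κ (Submodule.span κ (Linv c));
    (∀ m, Isol (run c₀ i t m) ∧ MultP (run c₀ i t m)) →
    (∀ m, OrdP (run c₀ i t m) ∧ dL (run c₀ i t m) = 1) →
    ∀ m, i (m + 1) = i m ∨ t (m + 1) (i m) ≠ 0

/-! ## The stubs — DISCHARGED by the landed Theorems files (no `sorry` left) -/

/-- **STUB (M/L, the dictionary; lead).** See `Sig.stub_dict`. [cite: arXiv:1802.05010, §3] -/
theorem stub_dict : Sig.stub_dict :=
  Summit.ResolutionOfSingularities.ResolutionOfSingularities.Theorems.NarrowRunsDie.stub_dict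

/-- **STUB (M).** See `Sig.stub_slice`. [cite: arXiv:1802.05010, §3] -/
theorem stub_slice : Sig.stub_slice :=
  Summit.ResolutionOfSingularities.ResolutionOfSingularities.Theorems.NarrowRunsDie.stub_slice

/-- **STUB (M, pure algebra).** See `Sig.stub_homogNear`. [cite: CossartJannsenSaito2020, Thm. 2.14] -/
theorem stub_homogNear : Sig.stub_homogNear :=
  Summit.ResolutionOfSingularities.ResolutionOfSingularities.Theorems.NarrowRunsDie.stub_homogNear

/-- **STUB (M, pure algebra).** See `Sig.stub_homogTrans`. [cite: CossartJannsenSaito2020, Thm. 3.14] -/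
theorem stub_homogTrans : Sig.stub_homogTrans :=
  Summit.ResolutionOfSingularities.ResolutionOfSingularities.Theorems.NarrowRunsDie.stub_homogTrans

/-- **STUB (M).** See `Sig.stub_coset`. [cite: arXiv:1802.05010, §3] -/
theorem stub_coset : Sig.stub_coset :=
  Summit.ResolutionOfSingularities.ResolutionOfSingularities.Theorems.NarrowRunsDie.stub_coset

/-- **STUB (M).** See `Sig.stub_partialsDivisible`. [cite: Kollar2007, §3.7] -/
theorem stub_partialsDivisible : Sig.stub_partialsDivisible :=
  Summit.ResolutionOfSingularities.ResolutionOfSingularities.Theorems.NarrowRunsDie.stub_partialsDivisible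

/-- **STUB (M).** See `Sig.stub_freeEndgame`. [folklore] -/
theorem stub_freeEndgame : Sig.stub_freeEndgame :=
  Summit.ResolutionOfSingularities.ResolutionOfSingularities.Theorems.NarrowRunsDie.stub_freeEndgame

/-! ## Proved glue -/

section ConeLemmas

open MvPolynomial

variable {κ : Type} [Field κ]

/-- Coefficients of the route's `cone` sum: the coefficient of `u^A` is `f A` if `|A| = p`, else `0`. -/
theorem coeff_coneSum (p n : ℕ) (f : (Fin n → ℕ) → κ) (A : Fin n →₀ ℕ) :
    MvPolynomial.coeff A (Finset.sum (Fintype.piFinset (fun _ : Fin n => Finset.range (p + 1)))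
      (fun B => @ite (MvPolynomial (Fin n) κ) (Finset.sum Finset.univ (fun j => B j) = p) (Classical.dec _)
        (MvPolynomial.monomial (Finsupp.equivFunOnFinite.symm B) (f B)) 0)) =
      if Finset.sum Finset.univ (fun j => A j) = p then f ⇑A else 0 := by
  classical
  rw [MvPolynomial.coeff_sum]
  have key : ∀ B ∈ Fintype.piFinset (fun _ : Fin n => Finset.range (p + 1)),
      MvPolynomial.coeff A (@ite (MvPolynomial (Fin n) κ) (Finset.sum Finset.univ (fun j => B j) = p)
        (Classical.dec _) (MvPolynomial.monomial (Finsupp.equivFunOnFinite.symm B) (f B)) 0) =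
      if B = ⇑A then (if Finset.sum Finset.univ (fun j => A j) = p then f ⇑A else 0) else 0 := by
    intro B _
    by_cases hB : B = ⇑A
    · subst hB
      rw [if_pos rfl]
      by_cases hs : Finset.sum Finset.univ (fun j => A j) = p
      · rw [if_pos hs, if_pos hs, MvPolynomial.coeff_monomial, if_pos (by simp)]
      · rw [if_neg hs, if_neg hs, MvPolynomial.coeff_zero]
    · rw [if_neg hB]
      by_cases hs : Finset.sum Finset.univ (fun j => B j) = p
      · rw [if_pos hs, MvPolynomial.coeff_monomial, if_neg]
        intro h
        apply hB
        rw [← h]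
        simp
      · rw [if_neg hs, MvPolynomial.coeff_zero]
  rw [Finset.sum_congr rfl key, Finset.sum_ite_eq']
  split_ifs with hmem hs
  · rfl
  · rfl
  · exfalso
    apply hmem
    rw [Fintype.mem_piFinset]
    intro j
    rw [Finset.mem_range]
    have : A j ≤ Finset.sum Finset.univ (fun j => A j) :=
      Finset.single_le_sum (f := fun j => A j) (fun _ _ => Nat.zero_le _) (Finset.mem_univ j)
    omega
  · rfl

/-- The route's `cone` sum is a form of degree `p`. -/
theorem isHomogeneous_coneSum (p n : ℕ) (f : (Fin n → ℕ) → κ) :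
    (Finset.sum (Fintype.piFinset (fun _ : Fin n => Finset.range (p + 1)))
      (fun B => @ite (MvPolynomial (Fin n) κ) (Finset.sum Finset.univ (fun j => B j) = p) (Classical.dec _)
        (MvPolynomial.monomial (Finsupp.equivFunOnFinite.symm B) (f B)) 0)).IsHomogeneous p := by
  classical
  rw [MvPolynomial.IsHomogeneous]
  -- degree-`p` support: read it off `coeff_coneSum`
  intro d hd
  have h := coeff_coneSum p n f d
  rw [h] at hd
  split_ifs at hd with hs
  · rw [← hs, Finsupp.weight_apply, Finsupp.sum_fintype]
    · simp
    · simp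
  · exact absurd rfl hd

end ConeLemmas

/-- **Near-invariance from the slice and the algebra** (PROVED): `MultP (step i τ c)` makes the cleaned
slice vanish in degrees `1 … p-1`, where cleaning is the identity; `stub_homogNear` concludes. -/
theorem nearInvariant_of (hd : Sig.stub_dict) (hs : Sig.stub_slice) (hh : Sig.stub_homogNear) :
    Sig.nearInvariant := by
  intro p hp n hn κ _ _ _ c i τ clean bl ord dv tr step MultP cone Linv hc hstep
  have hsl := hs hd p hp n hn κ c i τ hc
  show MvPolynomial.aeval _ (cone c) = _
  refine hh p hp n κ (cone c) i τ (isHomogeneous_coneSum p n (clean c)) ?_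
  intro A hAi hpos hlt
  have hndvd : ¬ ∀ j, p ∣ A j := by
    intro hall
    obtain ⟨j, hj⟩ : ∃ j, A j ≠ 0 := by
      by_contra hnone
      push Not at hnone
      have : Finset.sum Finset.univ (fun j => A j) = 0 := Finset.sum_eq_zero (fun j _ => hnone j)
      omega
    have hpj : p ≤ A j := Nat.le_of_dvd (Nat.pos_of_ne_zero hj) (hall j)
    have : A j ≤ Finset.sum Finset.univ (fun j => A j) :=
      Finset.single_le_sum (f := fun j => A j) (fun _ _ => Nat.zero_le _) (Finset.mem_univ j)
    omega
  have hA : step i τ c ⇑A = @ite κ (∀ j, p ∣ A j) (Classical.dec _) 0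
      (MvPolynomial.coeff (Finsupp.equivFunOnFinite.symm ⇑A)
        (MvPolynomial.aeval (fun j : Fin n => if j = i then (1 : MvPolynomial (Fin n) κ) else
          MvPolynomial.X j + MvPolynomial.C (τ j)) (cone c))) := hsl (⇑A) hAi
  rw [if_neg hndvd, Finsupp.equivFunOnFinite_symm_coe] at hA
  by_contra hne
  have h2 : clean (step i τ c) ⇑A ≠ 0 → p ≤ Finset.sum Finset.univ (fun j => A j) := hstep.2 (⇑A)
  have hcl : clean (step i τ c) ⇑A = step i τ c ⇑A := if_neg hndvd
  rw [hcl, hA] at h2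
  have := h2 hne
  omega

/-- **Transversality from the slice and the algebra** (PROVED): the slice identifies the `X_i`-free
degree-`p` coefficients of `cone (step i τ c)`; `stub_homogTrans` puts `w` in `Linv c`; `dL c = 1` and
`v_i = 1`, `w_i = 0` give `w = 0`. -/
theorem transversal_of (hd : Sig.stub_dict) (hs : Sig.stub_slice) (ht : Sig.stub_homogTrans) :
    Sig.transversal := by
  intro p hp n hn κ _ _ _ c i τ clean bl ord dv tr step MultP cone Linv dL hc hv hdL w hw hwi
  have hsl := hs hd p hp n hn κ c i τ hc
  -- `w ∈ Linv c`
  have hwL : w ∈ Linv c := by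
    show MvPolynomial.aeval _ (cone c) = _
    refine ht p hp n κ (cone c) (cone (step i τ c)) i τ w (isHomogeneous_coneSum p n (clean c))
      (isHomogeneous_coneSum p n (clean (step i τ c))) ?_ hwi hv ?_ hw
    · intro j
      show MvPolynomial.coeff _ (Finset.sum _ _) = 0
      rw [coeff_coneSum]
      split_ifs with hs'
      · show @ite κ (∀ j', p ∣ (Finsupp.single j p) j') (Classical.dec _) 0 (c ⇑(Finsupp.single j p)) = 0
        rw [if_pos]
        intro j'
        by_cases hjj : j' = j
        · subst hjj; simp
        · simp [Ne.symm hjj]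
      · rfl
    · intro A hAi hdeg
      show MvPolynomial.coeff A (Finset.sum _ _) = _
      rw [coeff_coneSum, if_pos hdeg]
      show @ite κ (∀ j, p ∣ A j) (Classical.dec _) 0 (step i τ c ⇑A) = _
      by_cases hall : ∀ j, p ∣ A j
      · rw [if_pos hall, if_pos hall]
      · have e : step i τ c ⇑A = @ite κ (∀ j, p ∣ A j) (Classical.dec _) 0
            (MvPolynomial.coeff (Finsupp.equivFunOnFinite.symm ⇑A)
              (MvPolynomial.aeval (fun j : Fin n => if j = i then (1 : MvPolynomial (Fin n) κ) else
                MvPolynomial.X j + MvPolynomial.C (τ j)) (cone c))) := hsl (⇑A) hAi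
        rw [if_neg hall, if_neg hall, e, if_neg hall, Finsupp.equivFunOnFinite_symm_coe]
  -- `dL c = 1`: the span is the line through `v`
  have hv0 : (⟨Function.update τ i 1, Submodule.subset_span hv⟩ : Submodule.span κ (Linv c)) ≠ 0 := by
    intro h
    have h' := congrArg (fun x : Submodule.span κ (Linv c) => (x : Fin n → κ) i) h
    simp at h'
  obtain ⟨a, ha⟩ := (finrank_eq_one_iff_of_nonzero' _ hv0).mp hdL ⟨w, Submodule.subset_span hwL⟩
  have ha' : a • Function.update τ i 1 = w := congrArg Subtype.val ha
  have hai : a = 0 := by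
    have := congrArg (fun x : Fin n → κ => x i) ha'
    simpa [hwi] using this
  rw [← ha', hai, zero_smul]

/-- The two one-step statements give the birth line's `stub_narrowIsFree` verbatim (PROVED). -/
theorem free_of_oneStep : Sig.nearInvariant → Sig.transversal → Sig.narrowIsFree := by
  intro h₁ h₂ p hp n hn κ _ _ _ c₀ i t clean bl ord dv tr step run ser pd jac Isol MultP OrdP cone Linv dL
    hall hnar m
  by_contra hcon
  have hne : i (m + 1) ≠ i m := fun h => hcon (Or.inl h)
  have ht : t (m + 1) (i m) = 0 := by_contra fun h => hcon (Or.inr h)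
  have hv0 : Function.update (t m) (i m) 1 ∈ Linv (run c₀ i t m) :=
    h₁ p hp n hn κ (run c₀ i t m) (i m) (t m) (hall m).2 (hall (m + 1)).2
  have hv1 : Function.update (t (m + 1)) (i (m + 1)) 1 ∈ Linv (run c₀ i t (m + 1)) :=
    h₁ p hp n hn κ (run c₀ i t (m + 1)) (i (m + 1)) (t (m + 1)) (hall (m + 1)).2 (hall (m + 1 + 1)).2
  have hw : Function.update (t (m + 1)) (i (m + 1)) 1 = 0 :=
    h₂ p hp n hn κ (run c₀ i t m) (i m) (t m) (hall m).2 hv0 (hnar m).2 _ hv1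
      (by rw [Function.update_of_ne hne.symm]; exact ht)
  have h1 : Function.update (t (m + 1)) (i (m + 1)) (1 : κ) (i (m + 1)) = 0 := by
    rw [hw]; rfl
  simp at h1

/-! ## The composition (kernel-checked; no `sorry` in its own term) -/

/-- **`NarrowRunsDie` from the seven stub statements** — PROVED: at a prime `p` (`p ≠ 2` unused) and
`n ≥ 3` (so `0 < n`), near-invariance + transversality make the run free (`free_of_oneStep`); the
Frobenius coset of `Φ_m(a₀)` and the derivation lift give `π_m Φ_m(∂_l a₀) ∈ (π_m^p)` for all `m, l`;
the free endgame contradicts isolatedness of the start state. -/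
theorem NarrowRunsDie_of : Sig.stub_dict → Sig.stub_slice → Sig.stub_homogNear → Sig.stub_homogTrans →
    Sig.stub_coset → Sig.stub_partialsDivisible → Sig.stub_freeEndgame → NarrowRunsDie := by
  intro hd hs hh ht h₃ h₄ h₅ p hp hp2 n hn κ _ _ _ c₀ i t clean bl ord dv tr step run ser pd jac Isol MultP OrdP cone Linv dL
    hall hnar
  have hn0 : 0 < n := by omega
  have hfree : ∀ m, i (m + 1) = i m ∨ t (m + 1) (i m) ≠ 0 :=
    free_of_oneStep (nearInvariant_of hd hs hh) (transversal_of hd hs ht) p hp n hn0 κ c₀ i t hall hnar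
  refine h₅ p hp n hn0 κ c₀ i t (hall 0).1 hfree ?_
  intro m l
  obtain ⟨b, hb⟩ := h₃ hd p hp n hn0 κ c₀ i t (fun m => (hall m).2) m
  exact h₄ p hp n hn0 κ i t m l _ _ b hb

/-- **The crux `NarrowRunsDie`, assembled from the seven registered stubs** (the only `sorry`s in its
closure are the stubs'). -/
theorem NarrowRunsDie_proof : NarrowRunsDie :=
  NarrowRunsDie_of stub_dict stub_slice stub_homogNear stub_homogTrans stub_coset stub_partialsDivisible
    stub_freeEndgame

/-! ## Proved sanity lemmas for the substitution `let`s (API seed for the stub provers)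

`fam i τ` is the substitution family inlined in the `sub` let; it `HasSubst` (so `sub i τ` is the
`κ`-algebra endomorphism `MvPowerSeries.substAlgHom`), fixes `X i`, sends `X j ↦ X i * (X j + C (τ j))`
for `j ≠ i`; and two `example`s show how the literal `let` text of the stubs reduces to it
(`piE 1 = X (i 0)`; at a chart change `Phi 2 (X (i 0)) = X (i 1) * (X (i 0) + C (t 1 (i 0)))`, the
unit factor used by `stub_freeEndgame`). -/

section SubSanity

open MvPowerSeries

variable {n : ℕ} {κ : Type} [Field κ]

/-- The substitution family of `sub i τ` (inlined verbatim in the `let`). -/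
def fam (i : Fin n) (τ : Fin n → κ) : Fin n → MvPowerSeries (Fin n) κ :=
  fun j : Fin n => @ite (MvPowerSeries (Fin n) κ) (j = i) (Classical.dec _) (MvPowerSeries.X i)
    (MvPowerSeries.X i * (MvPowerSeries.X j + MvPowerSeries.C (τ j)))

theorem fam_hasSubst (i : Fin n) (τ : Fin n → κ) : HasSubst (fam i τ) :=
  hasSubst_of_constantCoeff_zero (fun j => by
    unfold fam
    by_cases h : j = i
    · rw [if_pos h]; simp
    · rw [if_neg h]; simp)

theorem subst_fam_X_self (i : Fin n) (τ : Fin n → κ) :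
    subst (fam i τ) (X i : MvPowerSeries (Fin n) κ) = X i := by
  rw [subst_X (fam_hasSubst i τ)]; simp [fam]

theorem subst_fam_X_ne (i j : Fin n) (τ : Fin n → κ) (h : j ≠ i) :
    subst (fam i τ) (X j : MvPowerSeries (Fin n) κ) = X i * (X j + C (τ j)) := by
  rw [subst_X (fam_hasSubst i τ)]; simp [fam, h]

theorem subst_fam_one (i : Fin n) (τ : Fin n → κ) :
    subst (fam i τ) (1 : MvPowerSeries (Fin n) κ) = 1 := by
  rw [← coe_substAlgHom (fam_hasSubst i τ)]; exact map_one _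

theorem subst_fam_mul (i : Fin n) (τ : Fin n → κ) (f g : MvPowerSeries (Fin n) κ) :
    subst (fam i τ) (f * g) = subst (fam i τ) f * subst (fam i τ) g :=
  subst_mul (fam_hasSubst i τ) f g

/-- `piE 1 = X (i 0)`, against the literal `let` text of the stubs. -/
example (i : ℕ → Fin n) (t : ℕ → Fin n → κ) :
    (let sub : Fin n → (Fin n → κ) → MvPowerSeries (Fin n) κ → MvPowerSeries (Fin n) κ := fun i τ f => MvPowerSeries.subst (fun j : Fin n => @ite (MvPowerSeries (Fin n) κ) (j = i) (Classical.dec _) (MvPowerSeries.X i) (MvPowerSeries.X i * (MvPowerSeries.X j + MvPowerSeries.C (τ j)))) f;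
     let piE : ℕ → MvPowerSeries (Fin n) κ := fun m => @Nat.rec (fun _ => MvPowerSeries (Fin n) κ) 1 (fun k g => MvPowerSeries.X (i k) * sub (i k) (t k) g) m;
     piE 1 = MvPowerSeries.X (i 0)) := by
  intro sub piE
  show MvPowerSeries.X (i 0) * sub (i 0) (t 0) 1 = MvPowerSeries.X (i 0)
  have : sub (i 0) (t 0) 1 = 1 := subst_fam_one (i 0) (t 0)
  rw [this, mul_one]

/-- At a chart change, `Phi 2 (X (i 0)) = X (i 1) * (X (i 0) + C (t 1 (i 0)))` — a UNIT multiple of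
the new exceptional variable iff `t 1 (i 0) ≠ 0`, i.e. iff the step is free. -/
example (i : ℕ → Fin n) (t : ℕ → Fin n → κ) (h : i 1 ≠ i 0) :
    (let sub : Fin n → (Fin n → κ) → MvPowerSeries (Fin n) κ → MvPowerSeries (Fin n) κ := fun i τ f => MvPowerSeries.subst (fun j : Fin n => @ite (MvPowerSeries (Fin n) κ) (j = i) (Classical.dec _) (MvPowerSeries.X i) (MvPowerSeries.X i * (MvPowerSeries.X j + MvPowerSeries.C (τ j)))) f;
     let Phi : ℕ → MvPowerSeries (Fin n) κ → MvPowerSeries (Fin n) κ := fun m f => @Nat.rec (fun _ => MvPowerSeries (Fin n) κ) f (fun k g => sub (i k) (t k) g) m;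
     Phi 2 (MvPowerSeries.X (i 0)) = MvPowerSeries.X (i 1) * (MvPowerSeries.X (i 0) + MvPowerSeries.C (t 1 (i 0)))) := by
  intro sub Phi
  show sub (i 1) (t 1) (sub (i 0) (t 0) (MvPowerSeries.X (i 0))) = _
  have h0 : sub (i 0) (t 0) (MvPowerSeries.X (i 0)) = MvPowerSeries.X (i 0) := subst_fam_X_self (i 0) (t 0)
  rw [h0]
  exact subst_fam_X_ne (i 1) (i 0) (t 1) (Ne.symm h)

end SubSanity

end Summit.ResolutionOfSingularities.ResolutionOfSingularities.Cruxes.NarrowRunsDie.Lines.DerivLift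

end
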